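import Literature.AlgebraicGeometry.Frobenioids.ArchimedeanFSMMono
import Literature.AlgebraicGeometry.Frobenioids.ArchimedeanFSMOverIsoProofs
import Literature.AlgebraicGeometry.Frobenioids.ArchimedeanLargeArcs
import Literature.AlgebraicGeometry.Frobenioids.ArchimedeanAngloidCoAngular
import Literature.AlgebraicGeometry.Frobenioids.ArchimedeanMorphismTypes
import HarnessLib

/-!
# Frobenioids II, Proposition 3.4 (ii) under condition (b), for the angular Frobenioid `A`: PROOF
# (abc-iut cell, layer L1, node `FrdII:Prop3.4(ii)`, sub-nodes P34-L02/L03, chain LC-L1-2)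

Mochizuki, *The geometry of Frobenioids II: poly-Frobenioids*, Kyushu J. Math. **62** (2008)
401–460, §3, Proposition 3.4 (ii) p. 30, proof pp. 30–31 [cite: MochizukiFrdII2008, Prop 3.4 (ii) p.30].
PROOF-ONLY companion of `ArchimedeanFSM.lean` (statements, abc-iut-L1-t6); nothing is defined here.

> "(ii) Let `φ : A → B` be a monomorphism of `F` such that [at least] one of the following two
> conditions is satisfied: (a) `φ` projects to an isomorphism of `D₀`; (b) `φ` admits a factorization
> `A → A′ → B` as a composite of a morphism of Frobenius type `A → A′` and a linear morphism `A′ → B`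
> such that any isotropic hull `A′ → A″` of `A′` is either an isomorphism or a slit morphism. Then `φ`
> projects to a monomorphism `φ_D` of `D`."

abc-iut-L1-d3 proved the case `α_{D₀} = β_{D₀}` of the printed argument (`ArchimedeanFSMMono.lean`,
`C.exists_lift₂`; this covers condition (a)) and the Lemma 3.2 (ii) step of the other case
(`ArchimedeanConjugateArcs/Lifts.lean`). This file proves the whole item for `F = A`
(`A.propII : (towerA π).PropII`): if `α_{D₀} ≠ β_{D₀}` then `A` is complex, `B` is real, and condition
(b) is in force; its Frobenius-type factor `β : A → A′` is CO-ANGULAR IN `F`, which — tested against the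
factorization of `β` through the object carrying the product region `(c_β/|c_β|) · B_A ⋯ B_A` — gives
the reverse inclusion `B_{A′}|_{Base β} ⊆ (c_β/|c_β|) · B_A^{·d}` (`d = deg_Fr φ`); its middle object
`A′` has the ISOTROPIC HULL `A′ → (A′ with full angular part)` IN `F` (constructed, universal property
proved), so condition (b) makes `B_{A′}` all of `S¹` or a slit; hence a translate of `B_A^{·d}` misses at
most one point, and `ArchimedeanLargeArcs.lean` supplies the conjugate linear isometries
`a₀, b₀ : Z₀ → A₀` over `id`, `conj` with `φ₀ a₀ = φ₀ b₀`; lifting them over `α_D, β_D` and using that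
`φ` is a monomorphism gives `α_D = β_D` ("as desired", p. 31 l. 4). The common helpers (`D₀`-lemmas,
the `C₀`-factorization `C0.exists_factor_product`, the inverse of a rigid isomorphism
`C0.act_mem_carrier_of_isIso`) are reused for `N`, `R` in the sibling files. No statement of the paper
is strengthened; no side is taken on [IUTchIII] Cor. 3.12.
-/

namespace Literature.AlgebraicGeometry.Frobenioids

open CategoryTheory Set
open scoped Pointwise

noncomputable section

namespace ArchFrd

universe v u

/-! ### `D₀`: parallel pairs -/

namespace D0

/-- Two distinct parallel arrows of `D₀` go from `Spec ℂ` to `Spec ℂ`. [cite: MochizukiFrdII2008, §3 p.23] -/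
theorem eq_complex_of_ne {L K : D0} {f g : L ⟶ K} (h : f ≠ g) : L = complex ∧ K = complex := by
  cases K with
  | real => exact absurd (Subsingleton.elim f g) h
  | complex => exact ⟨eq_complex_of_hom_complex f, rfl⟩

/-- Every arrow of `D₀` into `Spec ℂ` is an isomorphism. [cite: MochizukiFrdII2008, §3 p.23] -/
theorem isIso_of_eq_complex {L K : D0} (f : L ⟶ K) (hK : K = complex) : IsIso f := by
  rcases isIso_or_eq f with hf | ⟨-, hK'⟩
  · exact hf
  · exact absurd (hK'.symm.trans hK) (by decide)

/-- An arrow coequalizing two distinct parallel arrows of `D₀` lands in `Spec ℝ`.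
[cite: MochizukiFrdII2008, §3 p.23] -/
theorem eq_real_of_comp_eq {L K M : D0} {f g : L ⟶ K} (h : f ≠ g) (k : K ⟶ M)
    (hk : f ≫ k = g ≫ k) : M = real := by
  rcases isReal_or_isComplex M with hM | hM
  · exact hM
  · haveI := isIso_of_eq_complex k hM
    exact absurd ((cancel_mono k).mp hk) h

/-- Two endomorphisms of an object of `D₀` both different from the identity coincide (`Aut(Spec ℂ)`
has two elements). [cite: MochizukiFrdII2008, §3 p.23] -/
theorem endo_eq_of_ne_id {K : D0} {f g : K ⟶ K} (hf : f ≠ 𝟙 K) (hg : g ≠ 𝟙 K) : f = g := by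
  cases K with
  | real => exact Subsingleton.elim f g
  | complex =>
    rcases hom_complex_complex_eq f with hf' | hf'
    · exact absurd hf' hf
    · rcases hom_complex_complex_eq g with hg' | hg'
      · exact absurd hg' hg
      · rw [hf', hg']

/-- Hom-sets of `D₀` have at most two elements: two arrows both different from a third coincide.
[cite: MochizukiFrdII2008, §3 p.23] -/
theorem hom_eq_of_ne_of_ne {L K : D0} {f g h : L ⟶ K} (hf : f ≠ h) (hg : g ≠ h) : f = g := by
  cases K with
  | real => exact Subsingleton.elim f g
  | complex =>
    obtain rfl : L = complex := eq_complex_of_hom_complex f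
    rcases hom_complex_complex_eq h with hh | hh <;> subst hh
    · exact endo_eq_of_ne_id hf hg
    · rcases hom_complex_complex_eq f with hf' | hf'
      · rcases hom_complex_complex_eq g with hg' | hg'
        · rw [hf', hg']
        · exact absurd hg' hg
      · exact absurd hf' hf

end D0

/-! ### `C₀`: the inverse of an isomorphism `(b, 1, 1)`, and the factorization through the product region -/

namespace C0

variable {X Y : C0}

/-- If `f = (b, 1, 1) : X → Y` is an isomorphism of `C₀`, then twisting by `b` carries the region of `Y`
INTO the region of `X` (its inverse is `(b⁻¹, 1, 1)`). [cite: MochizukiFrdII2008, Ex 3.3 (i) p.27] -/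
theorem act_mem_carrier_of_isIso (f : X ⟶ Y) [IsIso f] (hd : degFr f = 1) (hs : scalar f = 1)
    {y : ℂˣ} (hy : y ∈ Y.region.carrier) : (Base f).act y ∈ X.region.carrier := by
  have hfi : f ≫ inv f = 𝟙 X := IsIso.hom_inv_id f
  have hbase : Base f ≫ Base (inv f) = 𝟙 _ := by rw [← base_comp', hfi, base_id']
  haveI : IsIso (Base f) :=
    ⟨⟨Base (inv f), hbase, by rw [← base_comp', IsIso.inv_hom_id f, base_id']⟩⟩
  have hinv : inv (Base f) = Base (inv f) := IsIso.inv_eq_of_hom_inv_id hbase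
  have hdeg : (inv f).degFr = 1 := by
    have h := congrArg degFr hfi
    rw [degFr_comp', hd, one_mul, degFr_id'] at h
    exact h
  have hsc : (inv f).scalar = 1 := by
    have h := congrArg scalar hfi
    rw [scalar_comp', hs, one_pow, mul_one, scalar_id'] at h
    exact (D0.Hom.act (Base f)).injective (h.trans (map_one _).symm)
  have hm := (inv f).mapsTo
  rw [hsc, hdeg, one_smul, PNat.one_coe, pow_one] at hm
  obtain ⟨x, hx, hxy⟩ := hm hy
  -- `y = (Base (inv f)).act x`, so `(Base f).act y = x`
  rw [← hxy]
  change D0.galAct (D0.Hom.twists (Base f)) (D0.galAct (D0.Hom.twists (Base (inv f))) x) ∈ _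
  rw [← hinv, D0.twists_inv, D0.galAct_galAct]
  exact hx

/-- **The test factorization for co-angularity** (Ex. 3.3 (ii) "naively co-angular"): an arrow
`β = (b, d, c) : X → Y` of `C₀` factors as `(𝟙, d, c) : X → X‴` followed by `(b, 1, 1) : X‴ → Y`,
where `X‴` lies over `Base(X)` and carries the product region `(c/|c|) · B_X^{·d}` with the tip of `Y`;
the second factor is a linear isometry, the first is an isometry iff `β` is.
[cite: MochizukiFrdII2008, Ex 3.3 (ii) p.28] -/
theorem exists_factor_product (β : X ⟶ Y) :
    ∃ (Q : AngularRegion ℂ) (hQ : X.base = D0.real → Q.IsIsotropic)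
      (γ : X ⟶ C0.mk X.base Q hQ) (ι : C0.mk X.base Q hQ ⟶ Y),
      Q.dir = unitPart ℂ (scalar β) • X.region.dir ^ (degFr β : ℕ) ∧ Q.tip = Y.region.tip ∧
        γ ≫ ι = β ∧ Base γ = 𝟙 _ ∧ Base ι = Base β ∧ degFr ι = 1 ∧ scalar ι = 1 ∧
          PreFrobenioid.IsIsometry toElem ι ∧
            (PreFrobenioid.IsIsometry toElem β → PreFrobenioid.IsIsometry toElem γ) := by
  obtain ⟨n, hn⟩ : ∃ n : ℕ, (degFr β : ℕ) = n + 1 := ⟨_, (PNat.natPred_add_one _).symm⟩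
  -- the pulled-back region of `Y` along `b`, and the two halves of `β`'s condition (c)
  obtain ⟨P, hPc, hPt, hPd, -⟩ := exists_pulledRegion Y (Base β)
  have hmaps : scalar β • X.region.carrier ^ (n + 1) ⊆ P.carrier := by
    rw [← hn, hPc]; exact β.mapsTo
  obtain ⟨hdir, habs⟩ := (X.region.smul_carrier_pow_subset_iff P (scalar β) n).mp hmaps
  -- the product region
  obtain ⟨Q, hQd, hQt⟩ := exists_angularRegion
    (isOpen_smul (unitPart ℂ (scalar β)) (isOpen_pow X.region.isOpen_dir n))
    (isConnected_smul (unitPart ℂ (scalar β)) (isConnected_pow X.region.isConnected_dir n))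
    Y.region.tip
  have hQ : X.base = D0.real → Q.IsIsotropic := by
    intro h
    have hX : X.region.dir = univ := X.isIsotropic_of_isReal h
    show Q.dir = univ
    rw [hQd, hX, Set.univ_pow (Nat.succ_ne_zero n), Set.smul_set_univ]
  -- the first factor `(𝟙, d, c)`
  have hm₁ : scalar β • X.region.carrier ^ (degFr β : ℕ) ⊆ pullRegion (C0.mk X.base Q hQ) (𝟙 X.base) := by
    rw [show (𝟙 X.base) = 𝟙 (C0.mk X.base Q hQ).base from rfl, pullRegion_id, hn]
    change scalar β • X.region.carrier ^ (n + 1) ⊆ Q.carrier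
    rw [X.region.smul_carrier_pow_subset_iff Q (scalar β) n, hQd, hQt, ← hPt]
    exact ⟨le_rfl, habs⟩
  let γ : X ⟶ C0.mk X.base Q hQ := ⟨𝟙 X.base, β.degFr, β.scalar, β.scalar_mem, hm₁⟩
  -- the second factor `(b, 1, 1)`
  have hm₂ : (1 : ℂˣ) • (C0.mk X.base Q hQ).region.carrier ^ ((1 : ℕ+) : ℕ) ⊆ pullRegion Y (Base β) := by
    rw [one_smul, PNat.one_coe, pow_one, ← hPc]
    intro u hu
    rw [AngularRegion.mem_carrier_polar_iff] at hu ⊢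
    change unitPart ℂ u ∈ Q.dir ∧ absHom ℂ u ≤ Q.tip at hu
    rw [hQd, hQt, ← hPt] at hu
    exact ⟨hdir hu.1, hu.2⟩
  let ι : C0.mk X.base Q hQ ⟶ Y := ⟨β.base, 1, 1, one_mem _, hm₂⟩
  have hι : PreFrobenioid.IsIsometry toElem ι := by
    rw [A0.isIsometry_iff_norm_mul_tip_pow]
    change ‖((1 : ℂˣ) : ℂ)‖ * (Q.tip : ℝ) ^ ((1 : ℕ+) : ℕ) = (Y.region.tip : ℝ)
    rw [Units.val_one, norm_one, one_mul, PNat.one_coe, pow_one, hQt]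
  refine ⟨Q, hQ, γ, ι, by rw [hn]; exact hQd, hQt, ?_, rfl, rfl, rfl, rfl, hι, fun hβ => ?_⟩
  · refine hom_ext (Category.id_comp _) (mul_one _) ?_
    change D0.Hom.act (𝟙 X.base) 1 * scalar β ^ ((1 : ℕ+) : ℕ) = scalar β
    rw [map_one, one_mul, PNat.one_coe, pow_one]
  · rw [A0.isIsometry_iff_norm_mul_tip_pow] at hβ ⊢
    change ‖(scalar β : ℂ)‖ * X.tip ^ (degFr β : ℕ) = (Q.tip : ℝ)
    rw [hQt]
    exact hβ

/-- From the inclusion `twist_b(B_Y) ⊆ S` (in `C₀`, `b = Base(β)`) and `{z}ᶜ ⊆ B_Y`: a translate-free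
"misses at most one point" statement for `S`. [cite: MochizukiFrdII2008, Prop 3.4 (ii) p.30] -/
theorem compl_subset_of_act_mem (β : X ⟶ Y) {S : Set ↥(normOneSubgroup ℂ)}
    (hS : ∀ y ∈ Y.region.carrier, unitPart ℂ ((Base β).act y) ∈ S) {z : ↥(normOneSubgroup ℂ)}
    (hz : ({z}ᶜ : Set ↥(normOneSubgroup ℂ)) ⊆ Y.region.dir) :
    ∃ q : ↥(normOneSubgroup ℂ), ({q}ᶜ : Set ↥(normOneSubgroup ℂ)) ⊆ S := by
  -- the twist `t` on `O_ℂ^×` induced by `b`: the identity or inversion, an involution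
  let t : ↥(normOneSubgroup ℂ) → ↥(normOneSubgroup ℂ) :=
    fun w => unitPart ℂ ((Base β).act (w : ℂˣ))
  have ht : ∀ w, t (t w) = w := by
    intro w
    change unitPart ℂ (D0.galAct _ (unitPart ℂ (D0.galAct _ (w : ℂˣ)) : ℂˣ)) = w
    rw [unitPart_galAct_coe, unitPart_galAct_coe]
    cases D0.Hom.twists (Base β) <;> simp
  refine ⟨t z, fun w hw => ?_⟩
  have hw' : t w ≠ z := fun h => (Set.mem_compl_singleton_iff.mp hw) (by rw [← ht w, h])
  have hmem : ((t w : ↥(normOneSubgroup ℂ)) : ℂˣ) * ofPosReal ℂ Y.region.tip ∈ Y.region.carrier :=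
    (Y.region.coe_mul_ofPosReal_mem_carrier_iff _ _).mpr ⟨hz hw', le_rfl⟩
  have h := hS _ hmem
  rw [map_mul, unitPart_mul] at h
  have h1 : unitPart ℂ ((Base β).act (ofPosReal ℂ Y.region.tip)) = 1 := by
    change unitPart ℂ (D0.galAct _ (ofPosReal ℂ Y.region.tip)) = 1
    cases D0.Hom.twists (Base β)
    · rw [D0.galAct_false, unitPart_ofPosReal]
    · rw [unitPart_galAct_true, unitPart_ofPosReal, inv_one]
  rw [h1, mul_one] at h
  change t (t w) ∈ S at h
  rwa [ht] at h

end C0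

/-! ### The tower `A`: condition (b) forces a large angular part -/

variable {D : Type u} [Category.{v} D] (π : D ⥤ D0)

/-- The isotropic objects of `A` are the objects with full angular part (Ex. 3.3 (ii)/(iii), landed
dictionaries `Ex33iii_isotropic_iff_holds`, `Ex33ii_isotropic_iff_holds`). [cite: MochizukiFrdII2008, Ex 3.3 (iii) p.29] -/
theorem A.isIsotropic_iff_isNaivelyIsotropic (X : A π) :
    PreFrobenioid.IsIsotropic (A.toElem π) X ↔ X.obj.fst.IsNaivelyIsotropic :=
  (Ex33iii_isotropic_iff_holds π X).trans (Ex33ii_isotropic_iff_holds π X.obj)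

/-- **Step 1 for `A`** (co-angularity of the Frobenius-type factor, tested in `F`): for a morphism of
Frobenius type `β : X → X′` of `A`, the region of `X′` pulled back along `Base(β₀)` has angular part
INSIDE `(c_β/|c_β|) · B_X^{·deg β₀}`. [cite: MochizukiFrdII2008, Prop 3.4 (ii) p.30] -/
theorem A.act_mem_product_of_isFrobeniusType {X X' : A π} (β : X ⟶ X')
    (hβ : PreFrobenioid.IsFrobeniusType (A.toElem π) β) :
    ∀ y ∈ X'.obj.fst.region.carrier,
      unitPart ℂ ((C0.Base β.hom.fst).act y) ∈
        unitPart ℂ (C0.scalar β.hom.fst) • X.obj.fst.region.dir ^ (C0.degFr β.hom.fst : ℕ) := by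
  obtain ⟨⟨X₀, XD, ιX⟩⟩ := X
  obtain ⟨⟨X'₀, X'D, ιX'⟩⟩ := X'
  obtain ⟨⟨β₀, βD, wβ⟩, hβiso⟩ := β
  obtain ⟨⟨hco, -⟩, hbi⟩ := hβ
  haveI : IsIso βD := hbi
  obtain ⟨Q, hQ, γ₀, ι₀, hQd, hQt, hfac, hγb, hιb, hιd, hιs, hιiso, -⟩ := C0.exists_factor_product β₀
  -- the factorization inside `A`
  let X₃ : C π := ⟨C0.mk X₀.base Q hQ, XD, ιX⟩
  have wγ : (PreFrobenioid.baseFunctor C0.toElem).map γ₀ ≫ X₃.iso.hom = ιX.hom ≫ π.map (𝟙 XD) := by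
    change C0.Base γ₀ ≫ ιX.hom = ιX.hom ≫ π.map (𝟙 XD)
    rw [hγb, CategoryTheory.Functor.map_id, Category.id_comp, Category.comp_id]
  have wι : (PreFrobenioid.baseFunctor C0.toElem).map ι₀ ≫ ιX'.hom = X₃.iso.hom ≫ π.map βD := by
    change C0.Base ι₀ ≫ ιX'.hom = ιX.hom ≫ π.map βD
    rw [hιb]; exact wβ
  let γC : (⟨X₀, XD, ιX⟩ : C π) ⟶ X₃ := ⟨γ₀, 𝟙 XD, wγ⟩
  let ιC : X₃ ⟶ (⟨X'₀, X'D, ιX'⟩ : C π) := ⟨ι₀, βD, wι⟩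
  have hι₀ : PreFrobenioid.Div C0.toElem ι₀ = 1 := hιiso
  have hιA : PreFrobenioid.isometricMorphisms (C.toElem π) ιC := by
    change pull _ _ (PreFrobenioid.Div C0.toElem ι₀) = 1
    rw [hι₀, map_one]
  have hγA : PreFrobenioid.isometricMorphisms (C.toElem π) γC := by
    -- the composite `γ ≫ ι` is the isometry `β`, and `ι` is an isometry
    have h3 : PreFrobenioid.IsIsometry C0.toElem (γ₀ ≫ ι₀) := by rw [hfac]; exact hβiso
    have h := (C0.isIsometry_of_comp γ₀ ι₀ h3).1
    change pull _ _ (PreFrobenioid.Div C0.toElem γ₀) = 1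
    rw [show PreFrobenioid.Div C0.toElem γ₀ = 1 from h, map_one]
  let γA : (⟨⟨X₀, XD, ιX⟩⟩ : A π) ⟶ ⟨X₃⟩ := ⟨γC, hγA⟩
  let ιA : (⟨X₃⟩ : A π) ⟶ ⟨⟨X'₀, X'D, ιX'⟩⟩ := ⟨ιC, hιA⟩
  have hcomp : γA ≫ ιA ≫ 𝟙 _ = ⟨⟨β₀, βD, wβ⟩, hβiso⟩ := by
    rw [Category.comp_id]
    exact WideSubcategory.hom_ext _ (CFP.hom_ext hfac (Category.id_comp _))
  -- co-angularity forces `ι` to be an isomorphism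
  have hιIso : IsIso ιA := by
    refine hco γA ιA (𝟙 _) hcomp rfl (Subsingleton.elim _ _) ⟨hιd, ?_⟩ (Or.inr ?_)
    · change IsIso βD; infer_instance
    · change IsIso (𝟙 XD); infer_instance
  haveI : IsIso ιA.hom := by
    haveI := hιIso
    exact (inferInstance : IsIso ((A.ι π).map ιA))
  haveI : IsIso ι₀ := CFP.isIso_fst ιA.hom
  -- read off the inclusion from the inverse of `ι₀ = (b, 1, 1)`
  intro y hy
  have hmem := C0.act_mem_carrier_of_isIso ι₀ hιd hιs hy
  rw [hιb] at hmem
  have h := ((C0.mk X₀.base Q hQ).region.mem_carrier_polar_iff _).mp hmem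
  rw [← hQd]
  exact h.1

/-- **Step 2 for `A`** (the isotropic hull in `F`): for `X′ ∈ Ob(A)`, the inclusion of `X′` into the
object with the same base and tip and FULL angular part is an isotropic hull in `A`; hence condition
(b)'s clause yields: the angular part of `X′` misses at most one point.
[cite: MochizukiFrdII2008, Prop 3.4 (ii) p.30] -/
theorem A.compl_subset_dir_of_hulls (X' : A π)
    (hh : ∀ (X'' : A π) (h : X' ⟶ X''), PreFrobenioid.IsIsotropicHull (A.toElem π) h →
      IsIso h ∨ (towerA π).IsSlit h) :
    ∃ z : ↥(normOneSubgroup ℂ), ({z}ᶜ : Set ↥(normOneSubgroup ℂ)) ⊆ X'.obj.fst.region.dir := by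
  obtain ⟨⟨X'₀, X'D, ιX'⟩⟩ := X'
  -- the full object over the same base and its inclusion `h = (𝟙, 1, 1)`
  let F₀ : C0 := ⟨X'₀.base, AngularRegion.isotropicOfTip X'₀.region.tip,
    fun _ => AngularRegion.isIsotropic_isotropicOfTip _⟩
  have hF₀ : F₀.IsNaivelyIsotropic := AngularRegion.isIsotropic_isotropicOfTip _
  have hmh : (1 : ℂˣ) • X'₀.region.carrier ^ ((1 : ℕ+) : ℕ) ⊆ C0.pullRegion F₀ (𝟙 X'₀.base) := by
    rw [one_smul, PNat.one_coe, pow_one, show (𝟙 X'₀.base) = 𝟙 F₀.base from rfl, C0.pullRegion_id]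
    intro u hu
    rw [C0.mem_carrier_of_isIsotropic hF₀]
    exact ((X'₀.region.mem_carrier_polar_iff u).mp hu).2
  let h₀ : X'₀ ⟶ F₀ := ⟨𝟙 _, 1, 1, one_mem _, hmh⟩
  let FC : C π := ⟨F₀, X'D, ιX'⟩
  have wh : (PreFrobenioid.baseFunctor C0.toElem).map h₀ ≫ FC.iso.hom = ιX'.hom ≫ π.map (𝟙 X'D) := by
    change 𝟙 _ ≫ ιX'.hom = ιX'.hom ≫ π.map (𝟙 X'D)
    rw [CategoryTheory.Functor.map_id, Category.id_comp, Category.comp_id]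
  let hC : (⟨X'₀, X'D, ιX'⟩ : C π) ⟶ FC := ⟨h₀, 𝟙 X'D, wh⟩
  have hh₀ : PreFrobenioid.IsIsometry C0.toElem h₀ := by
    rw [A0.isIsometry_iff_norm_mul_tip_pow]
    change ‖((1 : ℂˣ) : ℂ)‖ * X'₀.tip ^ ((1 : ℕ+) : ℕ) = X'₀.tip
    rw [Units.val_one, norm_one, one_mul, PNat.one_coe, pow_one]
  have hhA : PreFrobenioid.isometricMorphisms (C.toElem π) hC := by
    change pull _ _ (PreFrobenioid.Div C0.toElem h₀) = 1
    rw [show PreFrobenioid.Div C0.toElem h₀ = 1 from hh₀, map_one]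
  let hA : (⟨⟨X'₀, X'D, ιX'⟩⟩ : A π) ⟶ ⟨FC⟩ := ⟨hC, hhA⟩
  -- `h` is an isotropic hull in `A`
  have hHull : PreFrobenioid.IsIsotropicHull (A.toElem π) hA := by
    refine ⟨Subsingleton.elim _ _, ⟨rfl, ?_⟩, ?_, ?_⟩
    · change IsIso (𝟙 X'D); infer_instance
    · exact (A.isIsotropic_iff_isNaivelyIsotropic π ⟨FC⟩).mpr hF₀
    · intro W γ hW
      have hWn : W.obj.fst.IsNaivelyIsotropic := (A.isIsotropic_iff_isNaivelyIsotropic π W).mp hW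
      obtain ⟨⟨W₀, WD, ιW⟩⟩ := W
      obtain ⟨⟨γ₀, γD, wγ⟩, hγiso⟩ := γ
      change W₀.IsNaivelyIsotropic at hWn
      have hγ₀ : PreFrobenioid.IsIsometry C0.toElem γ₀ := hγiso
      have hγeq := (A0.isIsometry_iff_norm_mul_tip_pow γ₀).mp hγ₀
      -- the extension `γ' = (Base γ₀, deg γ₀, c_γ) : F₀ → W₀`
      have hmγ' : C0.scalar γ₀ • F₀.region.carrier ^ (C0.degFr γ₀ : ℕ) ⊆ C0.pullRegion W₀ (C0.Base γ₀) := by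
        obtain ⟨PW, hPWc, hPWt, -, hPWi⟩ := exists_pulledRegion W₀ (C0.Base γ₀)
        obtain ⟨n, hn⟩ : ∃ n : ℕ, (C0.degFr γ₀ : ℕ) = n + 1 := ⟨_, (PNat.natPred_add_one _).symm⟩
        rw [← hPWc, hn, F₀.region.smul_carrier_pow_subset_iff PW (C0.scalar γ₀) n,
          show PW.dir = univ from hPWi hWn]
        refine ⟨subset_univ _, ?_⟩
        rw [AngularRegion.absHom_mul_pow_le_iff, hPWt, ← hn]
        exact hγeq.le
      let γ'₀ : F₀ ⟶ W₀ := ⟨γ₀.base, γ₀.degFr, γ₀.scalar, γ₀.scalar_mem, hmγ'⟩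
      have wγ' : (PreFrobenioid.baseFunctor C0.toElem).map γ'₀ ≫ ιW.hom = FC.iso.hom ≫ π.map γD := wγ
      let γ'C : FC ⟶ ⟨W₀, WD, ιW⟩ := ⟨γ'₀, γD, wγ'⟩
      have hγ'₀ : PreFrobenioid.IsIsometry C0.toElem γ'₀ := by
        rw [A0.isIsometry_iff_norm_mul_tip_pow]; exact hγeq
      have hγ'A : PreFrobenioid.isometricMorphisms (C.toElem π) γ'C := by
        change pull _ _ (PreFrobenioid.Div C0.toElem γ'₀) = 1
        rw [show PreFrobenioid.Div C0.toElem γ'₀ = 1 from hγ'₀, map_one]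
      have hfacγ : h₀ ≫ γ'₀ = γ₀ := by
        refine C0.hom_ext ?_ ?_ ?_
        · change 𝟙 _ ≫ γ₀.base = γ₀.base
          exact Category.id_comp _
        · change (1 : ℕ+) * γ₀.degFr = γ₀.degFr
          exact one_mul _
        · change D0.Hom.act (𝟙 X'₀.base) γ₀.scalar * 1 ^ (γ₀.degFr : ℕ) = γ₀.scalar
          rw [one_pow, mul_one]
          change D0.galAct (D0.Hom.twists (𝟙 X'₀.base)) γ₀.scalar = γ₀.scalar
          rw [D0.twists_id, D0.galAct_false]
      refine ⟨⟨γ'C, hγ'A⟩, ?_, ?_⟩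
      · exact WideSubcategory.hom_ext _ (CFP.hom_ext hfacγ (Category.id_comp _))
      · rintro ⟨⟨γ''₀, γ''D, wγ''⟩, hγ''⟩ hcomp
        have h1 : h₀ ≫ γ''₀ = γ₀ := congrArg (fun k => k.hom.fst) hcomp
        have h2 : 𝟙 X'D ≫ γ''D = γD := congrArg (fun k => k.hom.snd) hcomp
        rw [Category.id_comp] at h2
        subst h2
        have h3 : γ''₀ = γ'₀ := by
          have hb : 𝟙 _ ≫ γ''₀.base = γ₀.base := congrArg C0.Hom.base h1
          have hd : (1 : ℕ+) * γ''₀.degFr = γ₀.degFr := congrArg C0.Hom.degFr h1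
          have hs : D0.Hom.act (𝟙 X'₀.base) γ''₀.scalar * 1 ^ (γ''₀.degFr : ℕ) = γ₀.scalar :=
            congrArg C0.Hom.scalar h1
          rw [Category.id_comp] at hb
          rw [one_mul] at hd
          rw [one_pow, mul_one] at hs
          change D0.galAct (D0.Hom.twists (𝟙 X'₀.base)) γ''₀.scalar = γ₀.scalar at hs
          rw [D0.twists_id, D0.galAct_false] at hs
          exact C0.hom_ext hb hd hs
        subst h3
        rfl
  -- condition (b): `h` is an isomorphism or a slit morphism
  rcases hh ⟨FC⟩ hA hHull with hiso | hslit
  · -- `h` invertible: the full region maps back into `B_{X′}`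
    haveI : IsIso hA.hom := by
      haveI := hiso
      exact (inferInstance : IsIso ((A.ι π).map hA))
    haveI : IsIso h₀ := CFP.isIso_fst hA.hom
    refine ⟨1, fun w _ => ?_⟩
    have hmem : ((w : ↥(normOneSubgroup ℂ)) : ℂˣ) * ofPosReal ℂ X'₀.region.tip ∈ F₀.region.carrier := by
      rw [C0.mem_carrier_of_isIsotropic hF₀, map_mul, absHom_coe_normOne, one_mul, absHom_ofPosReal]
      exact le_rfl
    have h := C0.act_mem_carrier_of_isIso h₀ rfl rfl hmem
    change D0.galAct (D0.Hom.twists (𝟙 X'₀.base)) _ ∈ _ at h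
    rw [D0.twists_id, D0.galAct_false, AngularRegion.coe_mul_ofPosReal_mem_carrier_iff] at h
    exact h.1
  · obtain ⟨z, hz⟩ := hslit.2
    change X'₀.region.dir = {z}ᶜ at hz
    refine ⟨z, fun w hw => ?_⟩
    change w ∈ X'₀.region.dir
    rw [hz]
    exact hw

/-- **Steps 1–3 for `A`**: under condition (b), with `X` complex, a translate of the `deg_Fr(φ)`-fold
product of the angular part of `X` misses at most one point of `S¹`.
[cite: MochizukiFrdII2008, Prop 3.4 (ii) p.30] -/
theorem A.compl_subset_of_condB {X Y : A π} (φ : X ⟶ Y) (hb : (towerA π).CondB φ) :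
    ∃ (e q : ↥(normOneSubgroup ℂ)),
      ({q}ᶜ : Set ↥(normOneSubgroup ℂ)) ⊆ e • X.obj.fst.region.dir ^ (C0.degFr φ.hom.fst : ℕ) := by
  obtain ⟨X', β, α, hfac, hFT, hlin, hhull⟩ := hb
  have hlin' : C0.degFr α.hom.fst = 1 := hlin
  have hdeg : C0.degFr φ.hom.fst = C0.degFr β.hom.fst := by
    rw [← hfac]
    change C0.degFr (β.hom.fst ≫ α.hom.fst) = _
    rw [C0.degFr_comp', hlin', mul_one]
  obtain ⟨z, hz⟩ := A.compl_subset_dir_of_hulls π X' hhull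
  obtain ⟨q, hq⟩ := C0.compl_subset_of_act_mem β.hom.fst
    (A.act_mem_product_of_isFrobeniusType π β hFT) hz
  exact ⟨unitPart ℂ (C0.scalar β.hom.fst), q, by rw [hdeg]; exact hq⟩

/-! ### Proposition 3.4 (ii) for `F = A` -/

/-- **Proposition 3.4 (ii) for the angular Frobenioid `A`**, both conditions, AS TYPED: a monomorphism
`φ` of `A` satisfying (a) or (b) projects to a monomorphism of `D`. Given `α_D, β_D` with
`φ_D α_D = φ_D β_D`: if `α_{D₀} = β_{D₀}` they lift simultaneously over one linear isometry (abc-iut-L1-d3,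
`C.exists_lift₂`) and `φ` mono gives `α_D = β_D`; otherwise `A` is complex, `B` real, condition (b) is
in force and yields the conjugate pair of lifts (`C0.exists_conj_pair_of_compl_subset`), with the same
conclusion. [cite: MochizukiFrdII2008, Prop 3.4 (ii) p.30] -/
theorem A.propII : (towerA π).PropII := by
  intro X Y φ hφ hcond
  haveI := hφ
  refine ⟨fun {Zd} a b h => ?_⟩
  change a ≫ φ.hom.snd = b ≫ φ.hom.snd at h
  by_cases hab : π.map a = π.map b
  · -- the printed argument for `α_{D₀} = β_{D₀}` (covers condition (a))
    obtain ⟨Z', a', b', hfst, hab', hcomp, -, hdiv⟩ := C.exists_lift₂ π X.obj a b hab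
    have hdiv' : PreFrobenioid.Div C0.toElem a'.fst = 1 := hdiv
    have ha' : PreFrobenioid.isometricMorphisms (C.toElem π) a' := by
      change pull _ _ (PreFrobenioid.Div C0.toElem a'.fst) = 1
      rw [hdiv', map_one]
    have hb' : PreFrobenioid.isometricMorphisms (C.toElem π) b' := by
      change pull _ _ (PreFrobenioid.Div C0.toElem b'.fst) = 1
      rw [← hfst, hdiv', map_one]
    have heq : (⟨a', ha'⟩ : (⟨Z'⟩ : A π) ⟶ X) ≫ φ = (⟨b', hb'⟩ : (⟨Z'⟩ : A π) ⟶ X) ≫ φ :=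
      WideSubcategory.hom_ext _ (hcomp φ.hom h)
    exact hab' (congrArg InducedWideCategory.Hom.hom ((cancel_mono φ).mp heq))
  · -- `α_{D₀} ≠ β_{D₀}`: condition (b) and the conjugate pair of lifts
    have hb : (towerA π).CondB φ := by
      refine hcond.resolve_left fun ha => hab ?_
      exact map_eq_of_isIso_map π a b _ ha h
    obtain ⟨e, q, hbig⟩ := A.compl_subset_of_condB π φ hb
    obtain ⟨hZc, hXc⟩ := D0.eq_complex_of_ne hab
    have hYr : π.obj Y.obj.snd = D0.real :=
      D0.eq_real_of_comp_eq hab (π.map φ.hom.snd) (by rw [← Functor.map_comp, h, Functor.map_comp])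
    obtain ⟨⟨⟨KX, RX, hRX⟩, XD, ιX⟩⟩ := X
    obtain ⟨⟨⟨KY, RY, hRY⟩, YD, ιY⟩⟩ := Y
    obtain ⟨⟨φ₀, φD, wφ⟩, hφiso⟩ := φ
    change XD ⟶ YD at φD
    change Zd ⟶ XD at a b
    change a ≫ φD = b ≫ φD at h
    change π.obj XD = D0.complex at hXc
    change π.obj YD = D0.real at hYr
    have hKX : KX = D0.complex := by
      haveI : IsIso ιX.hom := ιX.isIso_hom
      exact (D0.eq_of_isIso ιX.hom).trans hXc
    have hKY : KY = D0.real := by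
      haveI : IsIso ιY.hom := ιY.isIso_hom
      exact (D0.eq_of_isIso ιY.hom).trans hYr
    subst hKX
    subst hKY
    change ({q}ᶜ : Set ↥(normOneSubgroup ℂ)) ⊆ e • RX.dir ^ (C0.degFr φ₀ : ℕ) at hbig
    obtain ⟨RZ, hRZ, a₀, b₀, ha₀b, hb₀b, -, -, ha₀i, hb₀i, hcomp₀⟩ :=
      C0.exists_conj_pair_of_compl_subset RX hRX RY hRY φ₀ hbig
    -- the object `Z` of `A` over `Z_D` carrying both lifts
    haveI : IsIso (π.map a) := D0.isIso_of_eq_complex _ hXc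
    let ea : π.obj Zd ≅ π.obj XD := asIso (π.map a)
    let ιZ : (PreFrobenioid.baseFunctor C0.toElem).obj (C0.mk D0.complex RZ hRZ) ≅ π.obj Zd :=
      ιX ≪≫ ea.symm
    have wa : (PreFrobenioid.baseFunctor C0.toElem).map a₀ ≫ ιX.hom = ιZ.hom ≫ π.map a := by
      rw [show (PreFrobenioid.baseFunctor C0.toElem).map a₀ = C0.Base a₀ from rfl, ha₀b]
      change 𝟙 _ ≫ ιX.hom = (ιX.hom ≫ ea.inv) ≫ ea.hom
      rw [Category.assoc, ea.inv_hom_id, Category.comp_id]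
      exact Category.id_comp _
    have wb : (PreFrobenioid.baseFunctor C0.toElem).map b₀ ≫ ιX.hom = ιZ.hom ≫ π.map b := by
      rw [show (PreFrobenioid.baseFunctor C0.toElem).map b₀ = C0.Base b₀ from rfl, hb₀b]
      change D0.conj ≫ ιX.hom = (ιX.hom ≫ ea.inv) ≫ π.map b
      -- `Hom(Spec ℂ, π X_D)` has two elements; both sides differ from `ιX`
      have h1 : D0.conj ≫ ιX.hom ≠ ιX.hom := by
        intro hc
        apply D0.conj_ne_id
        exact (cancel_mono ιX.hom).mp (hc.trans (Category.id_comp ιX.hom).symm)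
      have h2 : (ιX.hom ≫ ea.inv) ≫ π.map b ≠ ιX.hom := by
        intro hc
        apply hab
        rw [Category.assoc] at hc
        have h' : ea.inv ≫ π.map b = 𝟙 _ :=
          (cancel_epi ιX.hom).mp (hc.trans (Category.comp_id ιX.hom).symm)
        have h'' := (Iso.inv_comp_eq ea).mp h'
        rw [Category.comp_id] at h''
        exact h''.symm
      exact D0.hom_eq_of_ne_of_ne h1 h2
    let ZC : C π := ⟨C0.mk D0.complex RZ hRZ, Zd, ιZ⟩
    let XC : C π := ⟨C0.mk D0.complex RX hRX, XD, ιX⟩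
    let aC : ZC ⟶ XC := ⟨a₀, a, wa⟩
    let bC : ZC ⟶ XC := ⟨b₀, b, wb⟩
    have haA : PreFrobenioid.isometricMorphisms (C.toElem π) aC := by
      change pull _ _ (PreFrobenioid.Div C0.toElem a₀) = 1
      rw [show PreFrobenioid.Div C0.toElem a₀ = 1 from ha₀i, map_one]
    have hbA : PreFrobenioid.isometricMorphisms (C.toElem π) bC := by
      change pull _ _ (PreFrobenioid.Div C0.toElem b₀) = 1
      rw [show PreFrobenioid.Div C0.toElem b₀ = 1 from hb₀i, map_one]
    let aA : (⟨ZC⟩ : A π) ⟶ ⟨XC⟩ := ⟨aC, haA⟩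
    let bA : (⟨ZC⟩ : A π) ⟶ ⟨XC⟩ := ⟨bC, hbA⟩
    have heq : aA ≫ ⟨⟨φ₀, φD, wφ⟩, hφiso⟩ = bA ≫ ⟨⟨φ₀, φD, wφ⟩, hφiso⟩ :=
      WideSubcategory.hom_ext _ (CFP.hom_ext hcomp₀ h)
    exact congrArg (fun k => k.hom.snd) (hφ.right_cancellation _ _ heq)

end ArchFrd

end

end Literature.AlgebraicGeometry.Frobenioids
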